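import Summits.ValiantsHypothesis.ValiantsHypothesis.Theorems.LacunarySymmetroidMatrixDescartesKernelDefiniteJunctionRolle

/-!
# Kernel-definite junction, part 2: windows and gaps of a two-scale monomial family

Helper file for the stub `stub_kernelDefiniteJunction` of the line `junction_ceiling` (crux `MatrixDescartes`,
stmt-ValiantsHypothesis-18050).  The determinant of the junction pencil `H_Λ` is (up to a power of `x`) a member of a
TWO-SCALE MONOMIAL FAMILY
  `f Λ = ∑_{i ≤ I} ∑_{j ≤ J} F i j · Λ^{-j} · X^{i+j}`       (`F i j` = coefficient of `x^i y^j` in `det(P̃(x) + x^a Q̃(y))`,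
                                                              evaluated along `y = x / Λ`).
Counting the positive roots of `f Λ` for `Λ → ∞` is a Newton-polygon (patchworking) computation.  This file provides the
two local tools, stated for an abstract coefficient array `F` (no matrices, no definitions — the family and the edge
polynomials enter through defining hypotheses `hf`, `hE`):

* `window_count` — at a scale `x = τ^a · t` (`Λ = τ^N`), if the renormalised family converges coefficientwise to an EDGE
  polynomial `E` (balance condition `a (i + j) + e i j = N j + κ`, the terms with `e i j = 0` survive), then eventually
  the zeros of `f Λ` in the window `[τ^a α, τ^a β]` are at most the roots of `E` in `(α, β)` counted with multiplicity
  (part 1's engine `eventually_card_zeros_window_le`);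
* `eval_ne_zero_of_dominant` — in a GAP where one monomial dominates all others by the factor `2 (I+1) (J+1)`, `f Λ`
  has no zero; `mono_up` / `mono_down` are the two monomial comparisons used to verify domination.
[folklore] (Newton polygon / Viro patchworking count for a one-parameter family; elementary real analysis).
-/

-- `Summit.ValiantsHypothesis.ValiantsHypothesis.…` is the tree's mandated single-conjunct layout (Sub = Summit).
set_option linter.dupNamespace false
set_option autoImplicit false

namespace Summit.ValiantsHypothesis.ValiantsHypothesis.Theorems.LacunarySymmetroidMatrixDescartes.JunctionCeiling

open Polynomial Filter Set Topology Finset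
open scoped BigOperators

/-! ## 1. Monomial comparisons -/

/-- Upward comparison: for `x ≤ c τ^a` a monomial of higher `x`-degree `p ≥ q` is dominated, with the gain
`c^{p-q} τ^{-d}`, as soon as the `τ⁻¹`-exponents balance (`a (p − q) + s + d ≤ r`). [folklore] -/
theorem mono_up (τ x c : ℝ) (hτ : 1 ≤ τ) (hx : 0 < x) (hc : 0 < c) (a p q r s d : ℕ) (hpq : q ≤ p)
    (hexp : a * (p - q) + s + d ≤ r) (hxle : x ≤ c * τ ^ a) :
    x ^ p * (τ⁻¹) ^ r ≤ c ^ (p - q) * (τ⁻¹) ^ d * (x ^ q * (τ⁻¹) ^ s) := by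
  have hτ0 : 0 < τ := by linarith
  have hτi1 : τ⁻¹ ≤ 1 := inv_le_one_of_one_le₀ hτ
  have hτi0 : 0 ≤ τ⁻¹ := by positivity
  have h1 : x ^ p = x ^ q * x ^ (p - q) := by rw [← pow_add, Nat.add_sub_cancel' hpq]
  have h2 : x ^ (p - q) ≤ c ^ (p - q) * τ ^ (a * (p - q)) := by
    calc x ^ (p - q) ≤ (c * τ ^ a) ^ (p - q) := pow_le_pow_left₀ hx.le hxle _
      _ = c ^ (p - q) * τ ^ (a * (p - q)) := by rw [mul_pow, ← pow_mul]
  have h3 : (τ⁻¹) ^ r ≤ (τ⁻¹) ^ (a * (p - q) + s + d) := pow_le_pow_of_le_one hτi0 hτi1 hexp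
  have h4 : τ ^ (a * (p - q)) * (τ⁻¹) ^ (a * (p - q) + s + d) = (τ⁻¹) ^ d * (τ⁻¹) ^ s := by
    rw [pow_add, pow_add, inv_pow, inv_pow, inv_pow, ← mul_assoc, ← mul_assoc,
      mul_inv_cancel₀ (pow_ne_zero _ hτ0.ne'), one_mul, mul_comm]
  calc x ^ p * (τ⁻¹) ^ r = x ^ q * x ^ (p - q) * (τ⁻¹) ^ r := by rw [h1]
    _ ≤ x ^ q * (c ^ (p - q) * τ ^ (a * (p - q))) * (τ⁻¹) ^ (a * (p - q) + s + d) := by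
        gcongr
    _ = c ^ (p - q) * (τ⁻¹) ^ d * (x ^ q * (τ⁻¹) ^ s) := by
        rw [show x ^ q * (c ^ (p - q) * τ ^ (a * (p - q))) * (τ⁻¹) ^ (a * (p - q) + s + d)
            = c ^ (p - q) * x ^ q * (τ ^ (a * (p - q)) * (τ⁻¹) ^ (a * (p - q) + s + d)) by ring, h4]
        ring

/-- Downward comparison: for `x ≥ c τ^a` a monomial of lower `x`-degree `p ≤ q` is dominated, with the gain
`c^{-(q-p)} τ^{-d}`, as soon as `s + d ≤ a (q − p) + r`. [folklore] -/
theorem mono_down (τ x c : ℝ) (hτ : 1 ≤ τ) (hx : 0 < x) (hc : 0 < c) (a p q r s d : ℕ) (hpq : p ≤ q)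
    (hexp : s + d ≤ a * (q - p) + r) (hxge : c * τ ^ a ≤ x) :
    x ^ p * (τ⁻¹) ^ r ≤ (c⁻¹) ^ (q - p) * (τ⁻¹) ^ d * (x ^ q * (τ⁻¹) ^ s) := by
  have hτ0 : 0 < τ := by linarith
  have hτi1 : τ⁻¹ ≤ 1 := inv_le_one_of_one_le₀ hτ
  have hτi0 : 0 ≤ τ⁻¹ := by positivity
  have hca : 0 < c * τ ^ a := by positivity
  have h1 : x ^ q = x ^ p * x ^ (q - p) := by rw [← pow_add, Nat.add_sub_cancel' hpq]
  -- `x^{-(q-p)} ≤ (c τ^a)^{-(q-p)}`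
  have h2 : (x ^ (q - p))⁻¹ ≤ (c⁻¹) ^ (q - p) * (τ⁻¹) ^ (a * (q - p)) := by
    have : (c * τ ^ a) ^ (q - p) ≤ x ^ (q - p) := pow_le_pow_left₀ hca.le hxge _
    calc (x ^ (q - p))⁻¹ ≤ ((c * τ ^ a) ^ (q - p))⁻¹ := by
          exact inv_anti₀ (pow_pos hca _) this
      _ = (c⁻¹) ^ (q - p) * (τ⁻¹) ^ (a * (q - p)) := by
          rw [mul_pow, ← pow_mul, mul_inv, inv_pow, inv_pow]
  have h3 : (τ⁻¹) ^ (a * (q - p)) * (τ⁻¹) ^ r ≤ (τ⁻¹) ^ d * (τ⁻¹) ^ s := by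
    rw [← pow_add, ← pow_add]
    exact pow_le_pow_of_le_one hτi0 hτi1 (by omega)
  have hxp : 0 < x ^ p := pow_pos hx _
  have hxqp : 0 < x ^ (q - p) := pow_pos hx _
  calc x ^ p * (τ⁻¹) ^ r = x ^ q * (x ^ (q - p))⁻¹ * (τ⁻¹) ^ r := by
        rw [h1, mul_assoc (x ^ p), mul_inv_cancel₀ hxqp.ne', mul_one]
    _ ≤ x ^ q * ((c⁻¹) ^ (q - p) * (τ⁻¹) ^ (a * (q - p))) * (τ⁻¹) ^ r := by gcongr
    _ = (c⁻¹) ^ (q - p) * x ^ q * ((τ⁻¹) ^ (a * (q - p)) * (τ⁻¹) ^ r) := by ring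
    _ ≤ (c⁻¹) ^ (q - p) * x ^ q * ((τ⁻¹) ^ d * (τ⁻¹) ^ s) := by gcongr
    _ = (c⁻¹) ^ (q - p) * (τ⁻¹) ^ d * (x ^ q * (τ⁻¹) ^ s) := by ring

/-! ## 2. The family: evaluation and the gap lemma -/

/-- Evaluation of a double sum of monomials `C _ * X^(i+j)` termwise. [folklore] -/
theorem eval_family (G : ℕ → ℕ → ℝ) (I J : ℕ) (x : ℝ) :
    (∑ i ∈ range (I + 1), ∑ j ∈ range (J + 1), C (G i j) * X ^ (i + j) : ℝ[X]).eval x =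
      ∑ p ∈ range (I + 1) ×ˢ range (J + 1), G p.1 p.2 * x ^ (p.1 + p.2) := by
  rw [eval_finsetSum, Finset.sum_product]
  refine Finset.sum_congr rfl fun i _ => ?_
  rw [eval_finsetSum]
  refine Finset.sum_congr rfl fun j _ => ?_
  simp only [eval_mul, eval_C, eval_pow, eval_X]

/-- **Gap lemma.** If one monomial of `f Λ` dominates every other one at `x` by the factor `2 (I+1) (J+1)`, then
`(f Λ) (x) ≠ 0`. [folklore] -/
theorem eval_ne_zero_of_dominant (F : ℕ → ℕ → ℝ) (I J : ℕ) (f : ℝ → ℝ[X])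
    (hf : ∀ Λ, f Λ = ∑ i ∈ range (I + 1), ∑ j ∈ range (J + 1), C (F i j * (Λ⁻¹) ^ j) * X ^ (i + j))
    (Λ x : ℝ) (hΛ : 0 < Λ) (hx : 0 < x) (i₀ j₀ : ℕ) (hi₀ : i₀ ≤ I) (hj₀ : j₀ ≤ J) (hF₀ : F i₀ j₀ ≠ 0)
    (hdom : ∀ i ∈ range (I + 1), ∀ j ∈ range (J + 1), (i, j) ≠ (i₀, j₀) →
      |F i j| * (Λ⁻¹) ^ j * x ^ (i + j) ≤
        |F i₀ j₀| * (Λ⁻¹) ^ j₀ * x ^ (i₀ + j₀) / (2 * (((I : ℝ) + 1) * ((J : ℝ) + 1)))) :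
    (f Λ).eval x ≠ 0 := by
  rw [hf, eval_family]
  set s : Finset (ℕ × ℕ) := range (I + 1) ×ˢ range (J + 1) with hs
  set g : ℕ × ℕ → ℝ := fun p => F p.1 p.2 * (Λ⁻¹) ^ p.2 * x ^ (p.1 + p.2) with hg
  have hmem : (i₀, j₀) ∈ s := by
    rw [hs, Finset.mem_product]
    exact ⟨mem_range.2 (Nat.lt_succ_of_le hi₀), mem_range.2 (Nat.lt_succ_of_le hj₀)⟩
  set Mn : ℝ := |F i₀ j₀| * (Λ⁻¹) ^ j₀ * x ^ (i₀ + j₀) with hMn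
  have hMpos : 0 < Mn := by
    have := abs_pos.2 hF₀
    positivity
  have hmain : |g (i₀, j₀)| = Mn := by
    rw [hg, hMn]
    simp only
    rw [abs_mul, abs_mul, abs_of_pos (pow_pos (inv_pos.2 hΛ) _), abs_of_pos (pow_pos hx _)]
  have hcard : (s.card : ℝ) = ((I : ℝ) + 1) * ((J : ℝ) + 1) := by
    rw [hs, Finset.card_product, card_range, card_range]
    push_cast
    ring
  have hrest : |∑ p ∈ s.erase (i₀, j₀), g p| ≤ Mn / 2 := by
    refine (Finset.abs_sum_le_sum_abs _ _).trans ?_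
    have hle : ∀ p ∈ s.erase (i₀, j₀), |g p| ≤ Mn / (2 * (((I : ℝ) + 1) * ((J : ℝ) + 1))) := by
      intro p hp
      rw [Finset.mem_erase] at hp
      obtain ⟨hne, hp⟩ := hp
      rw [hs, Finset.mem_product] at hp
      have h := hdom p.1 hp.1 p.2 hp.2 (by rwa [ne_eq, Prod.ext_iff] at hne ⊢)
      rw [hg]
      simp only
      rw [abs_mul, abs_mul, abs_of_pos (pow_pos (inv_pos.2 hΛ) _), abs_of_pos (pow_pos hx _)]
      exact h
    refine (Finset.sum_le_sum hle).trans ?_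
    rw [Finset.sum_const, nsmul_eq_mul]
    have hc : ((s.erase (i₀, j₀)).card : ℝ) ≤ ((I : ℝ) + 1) * ((J : ℝ) + 1) := by
      rw [← hcard]
      exact_mod_cast Finset.card_erase_le
    have hpos : 0 < ((I : ℝ) + 1) * ((J : ℝ) + 1) := by positivity
    calc ((s.erase (i₀, j₀)).card : ℝ) * (Mn / (2 * (((I : ℝ) + 1) * ((J : ℝ) + 1))))
        ≤ (((I : ℝ) + 1) * ((J : ℝ) + 1)) * (Mn / (2 * (((I : ℝ) + 1) * ((J : ℝ) + 1)))) := by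
          gcongr
      _ = Mn / 2 := by field_simp
  rw [← Finset.add_sum_erase s g hmem]
  intro h0
  have h1 : g (i₀, j₀) = -∑ p ∈ s.erase (i₀, j₀), g p := by linarith
  have h2 : |g (i₀, j₀)| ≤ Mn / 2 := by rw [h1, abs_neg]; exact hrest
  rw [hmain] at h2
  linarith

/-! ## 3. Windows: the renormalised family converges to an edge polynomial -/

/-- Degree bound for a double sum of monomials `C _ * X^(i+j)`. [folklore] -/
theorem natDegree_family_le (G : ℕ → ℕ → ℝ) (I J : ℕ) :
    (∑ i ∈ range (I + 1), ∑ j ∈ range (J + 1), C (G i j) * X ^ (i + j) : ℝ[X]).natDegree ≤ I + J := by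
  refine natDegree_sum_le_of_forall_le _ _ fun i hi => natDegree_sum_le_of_forall_le _ _ fun j hj => ?_
  refine (natDegree_C_mul_X_pow_le _ _).trans ?_
  rw [Finset.mem_range] at hi hj
  omega

/-- Coefficients of a double sum of monomials `C _ * X^(i+j)`. [folklore] -/
theorem coeff_family (G : ℕ → ℕ → ℝ) (I J k : ℕ) :
    (∑ i ∈ range (I + 1), ∑ j ∈ range (J + 1), C (G i j) * X ^ (i + j) : ℝ[X]).coeff k =
      ∑ i ∈ range (I + 1), ∑ j ∈ range (J + 1), if k = i + j then G i j else 0 := by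
  rw [finsetSum_coeff]
  refine Finset.sum_congr rfl fun i _ => ?_
  rw [finsetSum_coeff]
  refine Finset.sum_congr rfl fun j _ => ?_
  rw [coeff_C_mul_X_pow]

/-- **Window count.**  Scale `x = τ^a t`, `Λ = τ^N`; under the balance condition `a (i+j) + e i j = N j + κ` on the
support, `τ^{-κ} (f Λ)(τ^a t) = ∑ F i j τ^{-e i j} t^{i+j}` converges coefficientwise to the edge polynomial
`E = ∑_{e i j = 0} F i j t^{i+j}`; hence (part 1) eventually the zeros of `f Λ` in `[τ^a α, τ^a β]` number at most the
roots of `E` in `(α, β)` with multiplicity, provided `E ≠ 0` and `E α, E β ≠ 0`. [folklore] -/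
theorem window_count (F : ℕ → ℕ → ℝ) (I J N a κ : ℕ) (e : ℕ → ℕ → ℕ)
    (hbal : ∀ i j, F i j ≠ 0 → a * (i + j) + e i j = N * j + κ)
    (f : ℝ → ℝ[X])
    (hf : ∀ Λ, f Λ = ∑ i ∈ range (I + 1), ∑ j ∈ range (J + 1), C (F i j * (Λ⁻¹) ^ j) * X ^ (i + j))
    (E : ℝ[X])
    (hE : E = ∑ i ∈ range (I + 1), ∑ j ∈ range (J + 1), C (if e i j = 0 then F i j else 0) * X ^ (i + j))
    (hE0 : E ≠ 0) (α β : ℝ) (hα : E.eval α ≠ 0) (hβ : E.eval β ≠ 0) :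
    ∀ᶠ τ : ℝ in atTop, ∀ Z : Finset ℝ,
      (∀ x ∈ Z, x ∈ Icc (τ ^ a * α) (τ ^ a * β) ∧ (f (τ ^ N)).eval x = 0) →
        Z.card ≤ Multiset.card (E.roots.filter (fun t => α < t ∧ t < β)) := by
  classical
  -- the renormalised family
  set sc : ℝ → ℝ[X] := fun τ =>
    ∑ i ∈ range (I + 1), ∑ j ∈ range (J + 1), C (F i j * (τ⁻¹) ^ (e i j)) * X ^ (i + j) with hsc
  have hdeg : ∀ τ, (sc τ).natDegree ≤ I + J := fun τ => natDegree_family_le _ I J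
  have hEdeg : E.natDegree ≤ I + J := by rw [hE]; exact natDegree_family_le _ I J
  have hconv : ∀ k, Tendsto (fun τ => (sc τ).coeff k) atTop (𝓝 (E.coeff k)) := by
    intro k
    have hE' : E.coeff k = ∑ i ∈ range (I + 1), ∑ j ∈ range (J + 1),
        if k = i + j then (if e i j = 0 then F i j else 0) else 0 := by
      rw [hE, coeff_family]
    simp only [hsc, coeff_family, hE']
    refine tendsto_finsetSum _ fun i _ => tendsto_finsetSum _ fun j _ => ?_
    split_ifs with h1 h2
    · simp only [h2, pow_zero, mul_one]
      exact tendsto_const_nhds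
    · have h0 : Tendsto (fun τ : ℝ => (τ⁻¹) ^ (e i j)) atTop (𝓝 0) := by
        have := (tendsto_inv_atTop_zero (𝕜 := ℝ)).pow (e i j)
        rwa [zero_pow h2] at this
      simpa using h0.const_mul (F i j)
    · exact tendsto_const_nhds
  -- pointwise identity between `sc τ` and `f (τ^N)`
  have hid : ∀ τ : ℝ, 0 < τ → ∀ t : ℝ,
      (sc τ).eval t = (τ ^ κ)⁻¹ * (f (τ ^ N)).eval (τ ^ a * t) := by
    intro τ hτ t
    have hτ0 : τ ≠ 0 := hτ.ne'
    simp only [hsc]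
    rw [hf, eval_family, eval_family, Finset.mul_sum]
    refine Finset.sum_congr rfl fun p _ => ?_
    by_cases hFp : F p.1 p.2 = 0
    · simp [hFp]
    · have hb := hbal p.1 p.2 hFp
      have key : (τ⁻¹) ^ (e p.1 p.2) = (τ ^ κ)⁻¹ * (((τ ^ N)⁻¹) ^ p.2 * (τ ^ a) ^ (p.1 + p.2)) := by
        have h1 : τ ^ (a * (p.1 + p.2)) = τ ^ (N * p.2) * τ ^ κ * (τ ^ e p.1 p.2)⁻¹ := by
          rw [eq_mul_inv_iff_mul_eq₀ (pow_ne_zero _ hτ0), ← pow_add, ← pow_add, hb]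
        simp only [inv_pow]
        rw [← pow_mul, ← pow_mul, h1]
        field_simp
      rw [mul_pow, key]
      ring
  have hτpos : ∀ᶠ τ : ℝ in atTop, 0 < τ := eventually_gt_atTop 0
  filter_upwards [eventually_card_zeros_window_le sc E (I + J) hdeg hE0 hEdeg hconv α β hα hβ, hτpos]
    with τ hτ hτ0 Z hZ
  have hτa : 0 < τ ^ a := pow_pos hτ0 a
  have hinj : Function.Injective (fun x : ℝ => x / τ ^ a) := fun x y hxy => by
    simpa [div_left_inj' hτa.ne'] using hxy
  rw [← Finset.card_image_of_injective Z hinj]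
  refine hτ (Z.image (fun x => x / τ ^ a)) fun t ht => ?_
  rw [Finset.mem_image] at ht
  obtain ⟨x, hx, rfl⟩ := ht
  obtain ⟨hxI, hfx⟩ := hZ x hx
  refine ⟨⟨?_, ?_⟩, ?_⟩
  · rw [le_div_iff₀ hτa, mul_comm]; exact hxI.1
  · rw [div_le_iff₀ hτa, mul_comm]; exact hxI.2
  · rw [hid τ hτ0, mul_div_cancel₀ _ hτa.ne', hfx, mul_zero]

end Summit.ValiantsHypothesis.ValiantsHypothesis.Theorems.LacunarySymmetroidMatrixDescartes.JunctionCeiling
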